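import Mathlib
import HarnessLib
import Summits.PneNP.PneNP.Theorems.UniformStreamUniformStreamLBStubBlockProduct
import Summits.PneNP.PneNP.Theorems.UniformStreamUniformStreamLBStubTruthTableBlocks
import Summits.PneNP.PneNP.Theorems.UniformStreamUniformStreamLBStubFamily
import Summits.PneNP.PneNP.Theorems.UniformStreamUniformStreamLBStubMixedCount
import Summits.PneNP.PneNP.Theorems.UniformStreamUniformStreamLBStubTransfer
import Summits.PneNP.PneNP.Theses.UniformStream
import Literature.Computability.Complexity.PaulPippengerSzemerediTrotter1983Clocks

/-!
# `UniformStreamLB` (stmt-PneNP-16045), line `birth` — calibration from BELOW: the levels `c ≤ 1`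

The crux `Summit.PneNP.PneNP.Theses.UniformStream.UniformStreamLB` asks for a time-constructible `s` such
that for EVERY level `c` no uniform one-pass streaming algorithm with space and per-machine step budget
`s(⌊log₂N⌋)^c + c` decides `MCSP[s]` (McKay–Murray–Williams, STOC 2019, Thm. 1.3, hypothesis). This file
settles, for the natural witness `s = id` (`MCSP[n ↦ n]`: truth tables of length `N = 2ⁿ` of functions of
`B₂`-circuit complexity `≤ n`), the LOW levels `c ≤ 1` UNCONDITIONALLY and NON-UNIFORMLY:

* `lowLevels` — there is a length `N₀` (namely `2^{2k+6}`, `k = 2^K`, any `K ≥ 200`) at which NO one-pass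
  streaming algorithm (`StreamingAlgorithm`: arbitrary init/update/accept maps per length) with at most
  `⌊log₂N₀⌋ + 1` state bits decides `MCSP[n ↦ n]`;
* `MCSPSize_id_not_mem_STREAM` — hence `MCSP[n ↦ n] ∉ STREAM (N ↦ ⌊log₂N⌋ + 1) T` for every update-time
  bound `T` (the tree's permissive non-uniform class of `Magnification.lean`);
* `uniformStreamLB_levels_le_one` — in particular the crux matrix with `s = id` has no decider at the levels
  `c = 0, 1` (budget `⌊log₂N⌋^c + c ≤ ⌊log₂N⌋ + 1`; the three `TM2` machines are not even inspected);
* `transfer_level` — the landed transfer (`stub_transfer`) level by level: a `DTISP(N·s(⌊log₂N⌋)^{c+1},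
  s(⌊log₂N⌋)^{c+1})` lower bound for `MCSP[s]` forbids the uniform streaming decider at level `c`;
* `uniformStreamLB_of_id_high` — hence a SHARPER sufficient condition for the crux than the line's open
  stub C⁺ (`∃ s ∀ c`): it is enough that `MCSP[n ↦ n] ∉ DTISP(N·⌊log₂N⌋^c, ⌊log₂N⌋^c)` for every `c ≥ 3`
  ("`MCSP[log N]` is not decidable in quasi-linear time and polylogarithmic space"), the levels `c ≤ 1`
  being supplied here and level `c ≥ 2` of the crux by level `c + 1 ≥ 3` of the `DTISP` bound.

So the open content of the crux starts exactly where information stops being the obstruction: from level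
`c = 2..4` on, a NON-uniform streaming algorithm exists (Nerode ceiling, banked at exponent `60` as
`uniformStream_nerodeCeilingMCSP_proof`), and every remaining level is uniformity-essential.

## The argument (block-product fooling set; one-way communication folklore)

Fix `k ≥ 1`, `n₀ = 2k + 6`, `N₀ = 2^{n₀} = 64 · 2^{2k}`. The `k^k` functions
`g_a(x) = ⋁_{i<k} (x_i ∧ x_{k+a(i)})`, `a : [k] → [k]`, on `2k` variables are pairwise distinct and cheap
(`stub_family`, ≤ `2k+2` gates even when read on the low `2k` of `n₀` variables), so each 64-fold repetition
`tt(g_a)^{64}` — the truth table of `g_a` lifted to `n₀` variables (`stub_truthTable_blocks`) — lies in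
`MCSP[n ↦ n]`. A one-pass algorithm with `≤ n₀ + 1` state bits at length `N₀` has `< 2^{n₀+2}` states; by
pigeonhole on the 63 block-boundary states of these constant words (`stub_blockProduct`) some `T` with
`k^k ≤ |T| · 2^{63(n₀+2)}` has ALL `|T|^{64}` mixed words `tt(g_{a₀}) ⋯ tt(g_{a₆₃})` accepted, hence in
`MCSP[n ↦ n]`; these are truth tables of pairwise distinct `n₀`-variable functions of circuit complexity
`≤ n₀`, of which there are at most `(2n₀+2)^{7n₀+2}` (`stub_mixed_count`, the circuit-code count of
Arora–Barak Thm. 6.21 as proved in `SizeClassCounting.lean`/`HiraharaTable.lean`). For `k = 2^K`, `K ≥ 200`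
the two bounds are incompatible (`stub_arith`): `(k^k)^{64} > (2n₀+2)^{7n₀+2} · 2^{4032(n₀+2)}`.

## References

* D. M. McKay, C. D. Murray, R. R. Williams, STOC 2019, doi:10.1145/3313276.3316396, Thm. 1.3 and §2
  (the streaming model; the crux is its hypothesis) [MckayMurrayWilliams2019].
* S. Arora, B. Barak, *Computational Complexity* (2009), Thm. 6.21 (count of small circuits)
  [AroraBarakCC2009].
* The lower-bound technique is the folklore one-way communication / crossing-sequence (fooling-set)
  argument for one-pass machines [folklore].
-/

noncomputable section

namespace Summit.PneNP.PneNP.Theorems.UniformStreamLB.Birth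

open Literature.Computability.Complexity Literature.Computability.MetaComplexity

/-- **Stub LOW-A (registered signature).** For `K ≥ 200`,
`(2(2·2^K+6)+2)^{7(2·2^K+6)+2} · 2^{4032(2·2^K+8)} < ((2^K)^{2^K})^{64}`: bound the base by `2^{K+3}`,
the exponent by `16·2^K`, the second factor's exponent by `8065·2^K`, and compare exponents of `2`:
`(16K + 8113)·2^K < 64K·2^K`. [folklore] -/
theorem stub_arith (K : ℕ) (hK : 200 ≤ K) :
    (2 * (2 * 2 ^ K + 6) + 2) ^ (7 * (2 * 2 ^ K + 6) + 2) * 2 ^ (4032 * (2 * 2 ^ K + 6 + 2)) <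
      ((2 ^ K) ^ (2 ^ K)) ^ 64 := by
  -- abbreviate P = 2^K and record its size
  obtain ⟨P, hP⟩ : ∃ P : ℕ, P = 2 ^ K := ⟨_, rfl⟩
  have hP15 : 2 ^ 15 ≤ P := hP ▸ Nat.pow_le_pow_right (by norm_num) (by omega)
  have hPbig : 32768 ≤ P := by simpa using hP15
  have hPpos : 0 < P := by omega
  rw [← hP]
  -- the first factor: base ≤ 8P = 2^(K+3), exponent ≤ 16P
  have hbase : 2 * (2 * P + 6) + 2 ≤ 2 ^ (K + 3) := by
    rw [pow_add, ← hP]; norm_num; omega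
  have hexp : 7 * (2 * P + 6) + 2 ≤ 16 * P := by omega
  have h1 : (2 * (2 * P + 6) + 2) ^ (7 * (2 * P + 6) + 2) ≤ 2 ^ ((K + 3) * (16 * P)) := by
    calc (2 * (2 * P + 6) + 2) ^ (7 * (2 * P + 6) + 2)
        ≤ (2 ^ (K + 3)) ^ (7 * (2 * P + 6) + 2) := Nat.pow_le_pow_left hbase _
      _ ≤ (2 ^ (K + 3)) ^ (16 * P) := Nat.pow_le_pow_right (by positivity) hexp
      _ = 2 ^ ((K + 3) * (16 * P)) := by rw [← pow_mul]
  -- the second factor: exponent ≤ 8065 P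
  have h2 : 2 ^ (4032 * (2 * P + 6 + 2)) ≤ 2 ^ (8065 * P) :=
    Nat.pow_le_pow_right (by norm_num) (by omega)
  -- the product
  have h12 : (2 * (2 * P + 6) + 2) ^ (7 * (2 * P + 6) + 2) * 2 ^ (4032 * (2 * P + 6 + 2)) ≤
      2 ^ ((16 * K + 8113) * P) := by
    calc (2 * (2 * P + 6) + 2) ^ (7 * (2 * P + 6) + 2) * 2 ^ (4032 * (2 * P + 6 + 2))
        ≤ 2 ^ ((K + 3) * (16 * P)) * 2 ^ (8065 * P) := Nat.mul_le_mul h1 h2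
      _ = 2 ^ ((16 * K + 8113) * P) := by rw [← pow_add]; ring_nf
  -- the right-hand side
  have hPP : P ^ P = 2 ^ (K * P) := by rw [pow_mul, ← hP]
  have hrhs : (P ^ P) ^ 64 = 2 ^ (64 * K * P) := by
    rw [hPP, ← pow_mul]; ring_nf
  rw [hrhs]
  refine lt_of_le_of_lt h12 (Nat.pow_lt_pow_right (by norm_num) ?_)
  have hlt : 16 * K + 8113 < 64 * K := by omega
  calc (16 * K + 8113) * P < 64 * K * P := Nat.mul_lt_mul_of_pos_right hlt hPpos
    _ = 64 * K * P := rfl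


/-- **The low levels, composed (sorry-free modulo the LOW stubs), parametric form.** For any `k ≥ 1`
satisfying the counting inequality `harith`, no one-pass streaming algorithm whose space at the single length
`N₀ = 2^{2k+6}` is at most `2k + 7 = ⌊log₂ N₀⌋ + 1` decides `MCSP[n ↦ n]` — whatever its update/accept maps
and however non-uniform. [folklore] -/
theorem lowLevels_of (k : ℕ) (hk1 : 1 ≤ k)
    (harith : (2 * (2 * k + 6) + 2) ^ (7 * (2 * k + 6) + 2) * 2 ^ (4032 * (2 * k + 6 + 2)) <
      (k ^ k) ^ 64)
    (A : StreamingAlgorithm) (S : ℕ → ℕ) (hS : A.HasSpace S)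
    (hSn : S (2 ^ (2 * k + 6)) ≤ 2 * k + 6 + 1) :
    ¬ A.Decides (MCSPSize fun n => n) := by
  intro hD
  obtain ⟨g, hginj, hgsize⟩ := stub_family k 6 hk1
  -- the blocks: truth tables of the family
  obtain ⟨W, hW⟩ : ∃ W : Finset (List Bool),
      W = Finset.univ.image fun a : Fin k → Fin k => truthTable (g a) := ⟨_, rfl⟩
  have hWcard : W.card = k ^ k := by
    rw [hW, Finset.card_image_of_injective _ fun a b h => hginj (truthTable_injective h),
      Finset.card_univ, Fintype.card_fun, Fintype.card_fin]
  have hWmem : ∀ w ∈ W, ∃ a : Fin k → Fin k, w = truthTable (g a) := by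
    intro w hw
    rw [hW, Finset.mem_image] at hw
    obtain ⟨a, -, ha⟩ := hw
    exact ⟨a, ha.symm⟩
  have hWlen : ∀ w ∈ W, w.length = 2 ^ (2 * k) := by
    intro w hw
    obtain ⟨a, rfl⟩ := hWmem w hw
    exact length_truthTable _
  -- constant words are truth tables of the lifted family members, of circuit size ≤ 2k+2 ≤ 2k+6
  have hconst : ∀ w ∈ W, (List.replicate (2 ^ 6) w).flatten ∈ MCSPSize fun n => n := by
    intro w hw
    obtain ⟨a, rfl⟩ := hWmem w hw
    have hblk := stub_truthTable_blocks (2 * k) 6 (fun _ => g a)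
    rw [List.ofFn_const] at hblk
    rw [← hblk, truthTable_mem_MCSPSize_iff]
    exact (hgsize a).trans (by omega)
  obtain ⟨T, hTW, hcard, hmix⟩ :=
    stub_blockProduct A S hS _ hD (2 ^ 6) (2 ^ (2 * k)) Nat.one_le_two_pow W hWlen hconst
  have hT := stub_mixed_count (2 * k) 6 T (fun w hw => hWlen w (hTW hw)) hmix
  -- the space exponent at N₀ = 2^6 · 2^(2k) = 2^(2k+6)
  have hN : (2 : ℕ) ^ 6 * 2 ^ (2 * k) = 2 ^ (2 * k + 6) := by rw [← pow_add, add_comm]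
  have hlog : S (2 ^ 6 * 2 ^ (2 * k)) + 1 ≤ 2 * k + 6 + 2 := by
    rw [hN]; omega
  have hexp : (S (2 ^ 6 * 2 ^ (2 * k)) + 1) * (2 ^ 6 - 1) ≤ (2 * k + 6 + 2) * 63 :=
    Nat.mul_le_mul hlog (by norm_num)
  have hcard' : k ^ k ≤ T.card * 2 ^ ((2 * k + 6 + 2) * 63) :=
    hWcard ▸ hcard.trans (Nat.mul_le_mul_left _ (Nat.pow_le_pow_right (by norm_num) hexp))
  -- raise to the 64th power and compare
  have h64 : (k ^ k) ^ 64 ≤ (T.card * 2 ^ ((2 * k + 6 + 2) * 63)) ^ 64 :=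
    Nat.pow_le_pow_left hcard' 64
  have hmul : (2 * k + 6 + 2) * 63 * 64 = 4032 * (2 * k + 6 + 2) := by ring
  have hsplit : (T.card * 2 ^ ((2 * k + 6 + 2) * 63)) ^ 64 =
      T.card ^ 64 * 2 ^ (4032 * (2 * k + 6 + 2)) := by
    rw [mul_pow, ← pow_mul, hmul]
  have hT' : T.card ^ 64 ≤ (2 * (2 * k + 6) + 2) ^ (7 * (2 * k + 6) + 2) := by simpa using hT
  have hfinal : (k ^ k) ^ 64 ≤
      (2 * (2 * k + 6) + 2) ^ (7 * (2 * k + 6) + 2) * 2 ^ (4032 * (2 * k + 6 + 2)) := by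
    rw [hsplit] at h64
    exact h64.trans (Nat.mul_le_mul_right _ hT')
  exact absurd (harith.trans_le hfinal) (lt_irrefl _)

/-- **The low levels**: there is a length `N₀` (namely `2^{2·2^K+6}`, any `K ≥ 200`) at which no
one-pass streaming algorithm with at most `⌊log₂ N₀⌋ + 1` state bits decides `MCSP[n ↦ n]` — whatever its
update/accept maps and however non-uniform. [folklore] -/
theorem lowLevels : ∃ N₀ : ℕ, ∀ (A : StreamingAlgorithm) (S : ℕ → ℕ), A.HasSpace S →
    S N₀ ≤ Nat.log 2 N₀ + 1 → ¬ A.Decides (MCSPSize fun n => n) := by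
  obtain ⟨K, hK⟩ : ∃ K : ℕ, 200 ≤ K := ⟨200, le_rfl⟩
  refine ⟨2 ^ (2 * 2 ^ K + 6), fun A S hS hSn => ?_⟩
  rw [Nat.log_pow (by norm_num)] at hSn
  exact lowLevels_of (2 ^ K) Nat.one_le_two_pow (stub_arith K hK) A S hS hSn

/-- **`MCSP[n ↦ n]` is not in the (non-uniform) one-pass streaming class with `⌊log₂N⌋ + 1` space**,
whatever the update-time bound `T`. [folklore] -/
theorem MCSPSize_id_not_mem_STREAM (T : ℕ → ℕ) :
    MCSPSize (fun n => n) ∉ STREAM (fun N => Nat.log 2 N + 1) T := by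
  rintro ⟨A, hS, -, hD⟩
  obtain ⟨N₀, hN₀⟩ := lowLevels
  exact hN₀ A _ hS le_rfl hD

/-- **Levels `c ≤ 1` of the crux matrix FAIL to have a decider, for `s = id`** (calibration from below:
the budget `⌊log₂N⌋^c + c ≤ ⌊log₂N⌋ + 1` is below the information-theoretic floor; the three machines are not
even looked at). [folklore] -/
theorem uniformStreamLB_levels_le_one (c : ℕ) (hc : c ≤ 1) :
    ¬ ∃ (A : StreamingAlgorithm) (M₀ M₁ M₂ : Turing.TM2ComputableAux Bool Bool),
      A.HasSpace (fun N => Nat.log 2 N ^ c + c) ∧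
      (∀ N : ℕ, M₀.OutputsWithin (Computability.encodeNat N) (A.init N) (Nat.log 2 N ^ c + c)) ∧
      (∀ (N : ℕ) (st : List Bool) (b : Bool), st.length ≤ Nat.log 2 N ^ c + c →
        M₁.OutputsWithin (boolPair st [b]) (A.update N st b) (Nat.log 2 N ^ c + c)) ∧
      (∀ (N : ℕ) (st : List Bool), st.length ≤ Nat.log 2 N ^ c + c →
        M₂.OutputsWithin st (Computability.encodeBool (A.accept N st)) (Nat.log 2 N ^ c + c)) ∧
      A.Decides (MCSPSize fun n => n) := by
  rintro ⟨A, -, -, -, hS, -, -, -, hD⟩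
  obtain ⟨N₀, hN₀⟩ := lowLevels
  refine hN₀ A _ hS ?_ hD
  interval_cases c <;> simp

/-- **Transfer, level by level.** For `s` with `s(n) ≥ n`, if `MCSP[s] ∉ DTISP(N·s(⌊log₂N⌋)^{c+1},
s(⌊log₂N⌋)^{c+1})` then no uniform one-pass streaming algorithm within budget `s(⌊log₂N⌋)^c + c` decides
`MCSP[s]` (the landed simulation `stub_simulation` puts it in `DTISP((N+1)(B+⌊log₂N⌋+1), B+⌊log₂N⌋+1)`,
inside the excluded class by `Transfer.budget_time_le` / `budget_space_le` and `Simulation.dtisp_mono_const`).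
[folklore] -/
theorem transfer_level (s : ℕ → ℕ) (hsge : ∀ n, n ≤ s n) (c : ℕ)
    (hno : MCSPSize s ∉ DTISP (fun N => N * s (Nat.log 2 N) ^ (c + 1)) (fun N => s (Nat.log 2 N) ^ (c + 1))) :
    ¬ ∃ (A : StreamingAlgorithm) (M₀ M₁ M₂ : Turing.TM2ComputableAux Bool Bool),
      A.HasSpace (fun N => s (Nat.log 2 N) ^ c + c) ∧
      (∀ N : ℕ, M₀.OutputsWithin (Computability.encodeNat N) (A.init N) (s (Nat.log 2 N) ^ c + c)) ∧
      (∀ (N : ℕ) (st : List Bool) (b : Bool), st.length ≤ s (Nat.log 2 N) ^ c + c →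
        M₁.OutputsWithin (boolPair st [b]) (A.update N st b) (s (Nat.log 2 N) ^ c + c)) ∧
      (∀ (N : ℕ) (st : List Bool), st.length ≤ s (Nat.log 2 N) ^ c + c →
        M₂.OutputsWithin st (Computability.encodeBool (A.accept N st)) (s (Nat.log 2 N) ^ c + c)) ∧
      A.Decides (MCSPSize s) := by
  intro hex
  have hmem := stub_simulation (fun N => s (Nat.log 2 N) ^ c + c) (MCSPSize s) hex
  exact hno (Simulation.dtisp_mono_const ((c + 3) * (s 0 ^ (c + 1) + 3))
    (fun N => Transfer.budget_time_le s hsge c N) (fun N => Transfer.budget_space_le s hsge c N) hmem)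

/-- **A sharper sufficient condition for the crux** (`s = id`, levels `≥ 3` of the `DTISP` bound only):
if `MCSP[n ↦ n] ∉ DTISP(N·⌊log₂N⌋^c, ⌊log₂N⌋^c)` for every `c ≥ 3`, then `UniformStreamLB` holds with the
witness `s = id` — levels `c ≤ 1` of its matrix by `uniformStreamLB_levels_le_one` (this file,
unconditional), level `c ≥ 2` by `transfer_level` at `c + 1 ≥ 3`, time-constructibility of `id` by
`isTimeConstructible_id`. The hypothesis is strictly weaker than the line's open stub
C⁺ = `∃ s TC ∀ c, MCSP[s] ∉ DTISP(N·s(⌊log₂N⌋)^c, s(⌊log₂N⌋)^c)` instantiated at `s = id` (it drops the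
levels `c ≤ 2`, where two-way small-space machines are NOT known to be weak), and it is still an open
problem of the magnification type (McKay–Murray–Williams 2019, Thm. 1.1/1.3). [folklore] -/
theorem uniformStreamLB_of_id_high
    (hhigh : ∀ c : ℕ, 3 ≤ c →
      MCSPSize (fun n => n) ∉ DTISP (fun N => N * Nat.log 2 N ^ c) (fun N => Nat.log 2 N ^ c)) :
    Summit.PneNP.PneNP.Theses.UniformStream.UniformStreamLB := by
  refine ⟨fun n => n, isTimeConstructible_id, fun c => ?_⟩
  by_cases hc : c ≤ 1
  · exact uniformStreamLB_levels_le_one c hc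
  · exact transfer_level (fun n => n) (fun n => le_rfl) c (hhigh (c + 1) (by omega))

end Summit.PneNP.PneNP.Theorems.UniformStreamLB.Birth

end
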